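import Literature.MathematicalPhysics.QuantumManyBody.PeriodicBoseGasEq229
import Literature.MathematicalPhysics.QuantumManyBody.PeriodicBoseGasThm21
import HarnessLib

/-!
# Fournais 2020, Lemma 2.4 proved: `Fournais2020_lemma24_holds`

Topic `Literature/MathematicalPhysics/QuantumManyBody` (provefact
`Literature.MathematicalPhysics.QuantumManyBody.BoseGas.Fournais2020_lemma24`, the named fact of
`PeriodicBoseGasSectorOps.lean`). [Fournais2020, Lemma 2.4 (2.26)] on the `n`-particle sector,
`∑ᵢ(T^{(i)} - bℓ⁻²Qᵢ) + A₂ ≥ -(n(n+1)/(2ℓ³))∫gω - Ca((n+1)/ℓ³)n₊ - Cnaℓ⁻³(1 + a²(n+1)²/ℓ² + (n+1)R²/ℓ²)`,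
is assembled in `PeriodicBoseGasLemma24.lean` from three inputs,
`Fournais2020_lemma24_of_facts : Fournais2020_eq228 → Fournais2020_eq229 → Fournais2020_eq242 → Fournais2020_lemma24`,
of which (2.28) (`Fournais2020_eq228_holds`, `PeriodicBoseGasEq228.lean`) and (2.42)
(`Fournais2020_eq242_holds`, `PeriodicBoseGasEq242.lean`) are proved. The remaining input, the pairing
identity (2.29), is proved in `PeriodicBoseGasEq229.lean` on the form domain of the box Hamiltonian,
i.e. under the finite-repulsion hypothesis `⟨Φ, ∑_{i<j}w(xᵢ,xⱼ)Φ⟩ < ∞` that `Fournais2020_lemma24` carries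
(`Fournais2020_eq229_of_rep`); this file re-runs the printed assembly with that input:

* `Fournais2020_lemma24_of_eq228_eq242` — verbatim the proof of `Fournais2020_lemma24_of_facts`
  ((2.30)–(2.42): kinetic lower bound, `2Ŵ₁(0)`-shift, completion of the square with the commutator
  bound, momentum integrals, Coulomb energy of `W₁`), with (2.29) supplied by `Fournais2020_eq229_of_rep`
  at the state `Φ` (whose repulsion is finite by hypothesis);
* `Fournais2020_lemma24_holds : Fournais2020_lemma24`;
* the two unrestricted facts downstream of it, by the reductions already in the tree:
  `Fournais2020_eq243_holds` ([Fournais2020, (2.43)–(2.46)], `Fournais2020_eq243_of_eq225_lemma24` with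
  `Fournais2020_eq225_holds`) and `Fournais2020_thm21_holds` ([Fournais2020, Thm. 2.1],
  `Fournais2020_thm21_of_eq243`).

No new definitions.

## References

* [Fournais2020] S. Fournais, *Length scales for BEC in the dilute Bose gas*, arXiv:2011.00309,
  EMS Ser. Congr. Rep. 18 (2021), doi:10.4171/ecr/18-1/7: Lemma 2.4, (2.26)–(2.43).
* [FournaisSolovej2020] S. Fournais, J. P. Solovej, *The energy of dilute Bose gases*, Ann. of Math. 192 (2020): App. A.
-/

noncomputable section

open MeasureTheory Set
open scoped ENNReal NNReal FourierTransform ComplexConjugate RealInnerProductSpace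

namespace Literature.MathematicalPhysics.QuantumManyBody.BoseGas

/-- **Lemma 2.4 of [Fournais2020] from (2.28) and (2.42)/(A.6)**, with (2.29) proved on the form domain
(`Fournais2020_eq229_of_rep`) — the printed proof: the kinetic form dominates `(ℓ³/n)∫τ‖b_pΦ‖²` (2.30),
`2Ŵ₁(0)∫‖b_pΦ‖² ≤ Ca n n₊/ℓ³` (2.32), `A₂ = ∫Ŵ₁Re⟨b†Φ,bΦ⟩` (2.29), completion of the square per `±p` with
the commutator (2.28) ((2.33)–(2.36)), the momentum integrals (2.36)–(2.41), and
`∫Ŵ₁²/(8π²p²) ≤ (1+C(R/ℓ)²)²∫gω ≤ …` (2.42). Verbatim `Fournais2020_lemma24_of_facts` but for the source of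
(2.29). [cite: Fournais2020, Lemma 2.4, (2.26)–(2.43)] -/
theorem Fournais2020_lemma24_of_eq228_eq242 (h228 : Fournais2020_eq228) (h242 : Fournais2020_eq242) :
    Fournais2020_lemma24 := by
  intro v hv hvi hsL ω hω χ hχ s hs R hR0 hR
  obtain ⟨CT, hCT0, hχC⟩ := hχ.one_sub_mul_sq_le_selfConv
  obtain ⟨Cχ, hCχ⟩ := hχ.hasCompactSupport.exists_bound_of_continuous hχ.contDiff.continuous
  have hχc : Continuous χ := hχ.contDiff.continuous
  have hCχ0 : 0 ≤ Cχ := (norm_nonneg _).trans (hCχ 0)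
  have hπ := Real.pi_pos
  -- the scattering length as a positive real
  have hsLt : scatteringLength v ≠ ⊤ := by
    refine scatteringLength_ne_top ?_
    rw [lintegral_const_mul' _ _ (ENNReal.inv_ne_top.2 two_ne_zero)]
    exact ENNReal.mul_ne_top (ENNReal.inv_ne_top.2 two_ne_zero) hvi
  set Cfull : ℝ := 32 * Real.pi * Cχ ^ 2 + 24 * Real.pi * CT + (32 / (3 * Real.pi * s ^ 3) / 2 + 16 / s) +
    (16 / s + 3072 * Real.pi * s / 2) + 1 with hCfull
  clear_value Cfull
  have hCfull_pos : 0 < Cfull := by rw [hCfull]; positivity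
  refine ⟨Cfull, 1 / Real.sqrt (2 * CT + 2), hCfull_pos, by positivity, ?_⟩
  intro b ℓ hb hℓ hRℓ a n u Φ hΦm _hΦs hN2 hrep hkin
  have ha_def : a = (scatteringLength v).toReal := rfl
  clear_value a
  have ha : 0 < a := by rw [ha_def]; exact ENNReal.toReal_pos hsL.ne' hsLt
  -- `R/ℓ` small
  have hε1 : 2 * CT * (R / ℓ) ^ 2 ≤ 1 := by
    have hRl : R / ℓ ≤ 1 / Real.sqrt (2 * CT + 2) := by
      rw [div_le_iff₀ hℓ]; exact hRℓ
    have h2 : (R / ℓ) ^ 2 ≤ 1 / (2 * CT + 2) :=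
      calc (R / ℓ) ^ 2 ≤ (1 / Real.sqrt (2 * CT + 2)) ^ 2 := pow_le_pow_left₀ (by positivity) hRl 2
        _ = 1 / (2 * CT + 2) := by rw [div_pow, one_pow, Real.sq_sqrt (by positivity)]
    have h3 : 2 * CT * (R / ℓ) ^ 2 ≤ 2 * CT * (1 / (2 * CT + 2)) := mul_le_mul_of_nonneg_left h2 (by positivity)
    have h4 : 2 * CT * (1 / (2 * CT + 2)) ≤ 1 := by
      rw [mul_one_div, div_le_one (by positivity)]; linarith
    linarith
  have hsmall : CT * (R / ℓ) ^ 2 ≤ 1 / 2 := by linarith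
  have hε0 : 0 ≤ 2 * CT * (R / ℓ) ^ 2 := by positivity
  -- trivial sector
  rcases Nat.eq_zero_or_pos n with hn0 | hnpos
  · subst hn0
    have hNP : nPlusBoxN ℓ u Φ = 0 := by simp [nPlusBoxN]
    have hA2 : a2Form v ω χ ℓ u Φ = 0 := by simp [a2Form]
    simp only [hNP, hA2, Nat.cast_zero, ENNReal.toReal_zero, mul_zero, zero_mul, zero_div, neg_zero, sub_zero,
      add_zero, zero_add]
    exact ENNReal.toReal_nonneg
  have hn1 : (1 : ℝ) ≤ n := by exact_mod_cast hnpos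
  have hn0' : (0 : ℝ) < n := by linarith
  -- parameters
  set κ : ℝ := ℓ ^ 3 / n with hκ
  set σ : ℝ := (s * ℓ)⁻¹ with hσ
  set ε : ℝ := 2 * CT * (R / ℓ) ^ 2 with hε
  set W0 : ℝ := (1 + ε) * (8 * Real.pi * a) with hW0
  set r₀ : ℝ := σ / Real.pi with hr₀
  clear_value W0 r₀
  clear_value ε σ κ
  have hκ0 : 0 < κ := by rw [hκ]; positivity
  have hσ0 : 0 < σ := by rw [hσ]; positivity
  have hW00 : 0 < W0 := by rw [hW0]; positivity
  have hr₀0 : 0 < r₀ := by rw [hr₀]; positivity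
  have hW016 : W0 ≤ 16 * Real.pi * a := by rw [hW0]; nlinarith
  have hsplit : 2 * σ ^ 2 ≤ 4 * Real.pi ^ 2 * r₀ ^ 2 := by
    rw [hr₀, div_pow]; field_simp; nlinarith [sq_nonneg σ]
  -- the functions of the momentum
  set W₁ : Space → ℂ := fun x => ((bigW₁ v ω χ ℓ x).toReal : ℂ) with hW₁
  set Wh : Space → ℝ := fun p => (𝓕 W₁ p).re with hWh
  set Nb : Space → ℝ≥0∞ := fun p => ∫⁻ X in boxConfig n ℓ u, ((‖bVec χ ℓ u p Φ X‖₊ : ℝ≥0∞)) ^ 2 with hNb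
  clear_value Nb Wh W₁
  obtain ⟨hW₁i, hW₁int⟩ := integral_toReal_bigW₁_le_sharp hv.1 hR hvi hℓ hCT0 hχ hχC hsmall hω
  have hWhb : ∀ p, |Wh p| ≤ W0 := fun p => by
    simp only [hWh, hW₁]
    refine (Complex.abs_re_le_norm _).trans ((norm_fourier_bigW₁_le_sharp hv.1 hR hvi hℓ hCT0 hχ hχC
      hsmall hω p).trans_eq ?_)
    rw [hW0, hε, ha_def]
  have hWc : Continuous (𝓕 W₁) := by
    rw [hW₁]; exact Literature.Analysis.FluidPDE.FourierNS.continuous_fourierIntegral hW₁i.ofReal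
  have hWhc : Continuous Wh := by rw [hWh]; exact Complex.continuous_re.comp hWc
  have hWhe : ∀ p, Wh (-p) = Wh p := fun p => by
    simp only [hWh, hW₁]; rw [fourier_bigW₁_neg v hω hχ ℓ p]
  have hNbm : Measurable Nb := by rw [hNb]; exact measurable_lintegral_normSq_bVec hχc ℓ u hΦm
  -- finiteness of `n₊` and the kinetic split (2.43)
  have hc3 : (ENNReal.ofReal ℓ ^ 3)⁻¹ = ENNReal.ofReal (ℓ ^ 3)⁻¹ := by
    rw [ENNReal.ofReal_inv_of_pos (by positivity), ENNReal.ofReal_pow hℓ.le]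
  have hNPt : nPlusBoxN ℓ u Φ ≠ ⊤ := by
    intro htop
    have h := kinExcForm_add_le_kinBoxN χ ℓ s b u Φ
    rw [htop, ENNReal.mul_top (by simpa using div_pos hb (pow_pos hℓ 2)), add_top, top_le_iff] at h
    exact hkin h
  obtain ⟨hTt, hsplitK⟩ := toReal_kinExcForm_add_le χ ℓ s (b := b) (by positivity) u Φ hkin hNPt
  -- (2.30) and (2.32) as real integrals
  have h230 := lintegral_tau_normSq_bVec_le hχc hℓ s u hΦm (Φ := Φ)
  have h232 := lintegral_lintegral_normSq_bVec_le hχc hCχ hℓ u hΦm (Φ := Φ)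
  set τr : Space → ℝ := fun p => max (4 * Real.pi ^ 2 * ‖p‖ ^ 2 - σ ^ 2) 0 with hτr
  clear_value τr
  have hτ0 : ∀ p, 0 ≤ τr p := fun p => by rw [hτr]; exact le_max_right _ _
  have hτr' : ∀ p : Space, max (4 * Real.pi ^ 2 * ‖p‖ ^ 2 - σ ^ 2) 0 = τr p := fun p => by rw [hτr]
  have hτm : Measurable τr := by
    rw [hτr]
    refine Measurable.max ?_ measurable_const
    exact (measurable_const.mul (measurable_norm.pow_const 2)).sub measurable_const
  have hτeq : ∀ p, ENNReal.ofReal (τr p) = ENNReal.ofReal (4 * Real.pi ^ 2 * ‖p‖ ^ 2 - (s * ℓ)⁻¹ ^ 2) := fun p => by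
    simp only [hτr, hσ]
    rcases le_total (4 * Real.pi ^ 2 * ‖p‖ ^ 2 - (s * ℓ)⁻¹ ^ 2) 0 with h | h
    · rw [max_eq_right h, ENNReal.ofReal_zero, ENNReal.ofReal_of_nonpos h]
    · rw [max_eq_left h]
  obtain ⟨hIτ, hIτle⟩ := integrable_and_integral_le hτm hτ0 hNbm
    (B := n * (ENNReal.ofReal ℓ ^ 3)⁻¹ * kinExcForm χ ℓ s u Φ) (by rw [hNb]; simpa only [hτeq] using h230)
    (ENNReal.mul_ne_top (ENNReal.mul_ne_top (ENNReal.natCast_ne_top n) (ENNReal.inv_ne_top.2 (by positivity))) hTt)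
  obtain ⟨hI0, hI0le⟩ := integrable_and_integral_le (g := fun _ => (1 : ℝ)) measurable_const (fun _ => zero_le_one) hNbm
    (B := ENNReal.ofReal (Cχ ^ 2) * n * (ENNReal.ofReal ℓ ^ 3)⁻¹ * nPlusBoxN ℓ u Φ) (by rw [hNb]; simpa using h232)
    (ENNReal.mul_ne_top (ENNReal.mul_ne_top (ENNReal.mul_ne_top ENNReal.ofReal_ne_top (ENNReal.natCast_ne_top n))
      (ENNReal.inv_ne_top.2 (by positivity))) hNPt)
  simp only [one_mul] at hI0 hI0le
  have hIτle' : ∫ p, τr p * (Nb p).toReal ≤ n / ℓ ^ 3 * (kinExcForm χ ℓ s u Φ).toReal := by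
    refine hIτle.trans_eq ?_
    rw [ENNReal.toReal_mul, ENNReal.toReal_mul, ENNReal.toReal_natCast, hc3, ENNReal.toReal_ofReal (by positivity)]
    ring
  have hI0le' : ∫ p, (Nb p).toReal ≤ Cχ ^ 2 * n / ℓ ^ 3 * (nPlusBoxN ℓ u Φ).toReal := by
    refine hI0le.trans_eq ?_
    rw [ENNReal.toReal_mul, ENNReal.toReal_mul, ENNReal.toReal_mul, ENNReal.toReal_natCast, hc3,
      ENNReal.toReal_ofReal (by positivity), ENNReal.toReal_ofReal (by positivity)]
    ring
  have hI00 : 0 ≤ ∫ p, (Nb p).toReal := integral_nonneg fun p => ENNReal.toReal_nonneg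
  -- (2.29)
  obtain ⟨hIP0, hA20⟩ := Fournais2020_eq229_of_rep v hv hvi ω hω χ hχ CT R hCT0 hχC hR0 hR ℓ s b hℓ hs hb hsmall n u Φ
    hΦm hN2 hrep hkin
  have hIP : Integrable fun p : Space => Wh p * pairingRe χ ℓ u p Φ := by simpa only [hWh, hW₁] using hIP0
  have hA2 : a2Form v ω χ ℓ u Φ = ∫ p : Space, Wh p * pairingRe χ ℓ u p Φ := by simpa only [hWh, hW₁] using hA20
  clear hIP0 hA20
  -- the weight `𝒜 = κτ + 2W₀` and the integrability of `𝒜‖b_pΦ‖²`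
  have hIN : Integrable fun p : Space => (κ * τr p + 2 * W0) * (Nb p).toReal := by
    have : (fun p : Space => (κ * τr p + 2 * W0) * (Nb p).toReal) =
        fun p => κ * (τr p * (Nb p).toReal) + 2 * W0 * (Nb p).toReal := by funext p; ring
    rw [this]
    exact (hIτ.const_mul κ).add (hI0.const_mul _)
  have hINval : ∫ p, (κ * τr p + 2 * W0) * (Nb p).toReal =
      κ * (∫ p, τr p * (Nb p).toReal) + 2 * W0 * ∫ p, (Nb p).toReal := by
    have : (fun p : Space => (κ * τr p + 2 * W0) * (Nb p).toReal) =
        fun p => κ * (τr p * (Nb p).toReal) + 2 * W0 * (Nb p).toReal := by funext p; ring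
    rw [this, integral_add (hIτ.const_mul κ) (hI0.const_mul _), integral_const_mul, integral_const_mul]
  -- (2.36)–(2.42): the momentum integral of `𝒜 - √(𝒜² - Ŵ₁²)`
  obtain ⟨D, hD⟩ : ∃ D : Space → ℝ, D = fun p => (κ * τr p + 2 * W0) - Real.sqrt ((κ * τr p + 2 * W0) ^ 2 - Wh p ^ 2) :=
    ⟨_, rfl⟩
  have hDA : ∀ p, D p = (κ * τr p + 2 * W0) - Real.sqrt ((κ * τr p + 2 * W0) ^ 2 - Wh p ^ 2) := fun p => by rw [hD]
  have hDm : Measurable D := by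
    rw [hD]
    refine ((measurable_const.mul hτm).add measurable_const).sub ?_
    exact (((measurable_const.mul hτm).add measurable_const).pow_const 2 |>.sub (hWhc.measurable.pow_const 2)).sqrt
  have hA0 : ∀ p, 0 < κ * τr p + 2 * W0 := fun p => by
    have := mul_nonneg hκ0.le (hτ0 p)
    linarith
  have hAW : ∀ p, |Wh p| ≤ κ * τr p + 2 * W0 := fun p => by
    have := mul_nonneg hκ0.le (hτ0 p)
    have := hWhb p
    linarith
  have hAe : ∀ p, κ * τr (-p) + 2 * W0 = κ * τr p + 2 * W0 := fun p => by simp only [hτr, norm_neg]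
  have hD0 : ∀ p, 0 ≤ D p := fun p => by
    rw [hDA p, sub_nonneg]
    calc Real.sqrt ((κ * τr p + 2 * W0) ^ 2 - Wh p ^ 2) ≤ Real.sqrt ((κ * τr p + 2 * W0) ^ 2) :=
          Real.sqrt_le_sqrt (sub_le_self _ (sq_nonneg _))
      _ = κ * τr p + 2 * W0 := Real.sqrt_sq (hA0 p).le
  have hLint := lintegral_bogoliubov_integrand_le hκ0 hW00 hr₀0 (σ := σ) hsplit hWhc.measurable hWhb
  simp only [hτr'] at hLint
  -- Coulomb energy of `W₁` (2.42)
  have h242' := h242 v hv hvi ω hω χ hχ CT R hCT0 hχC hR0 hR ℓ hℓ hsmall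
  rw [← hε, ← hW₁] at h242'
  have hgΩt : gOmegaIntegral v ω ≠ ⊤ :=
    ne_top_of_le_ne_top (ENNReal.mul_ne_top ENNReal.ofReal_ne_top hsLt) (gOmegaIntegral_le hω)
  have hCoul : ∫⁻ p : Space, ENNReal.ofReal (Wh p ^ 2 / (8 * Real.pi ^ 2 * ‖p‖ ^ 2)) ≤
      ENNReal.ofReal ((1 + ε) ^ 2) * gOmegaIntegral v ω := by
    refine (lintegral_mono fun p => ENNReal.ofReal_le_ofReal ?_).trans h242'
    have hre := abs_le.1 (Complex.abs_re_le_norm (𝓕 W₁ p))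
    have hWp : Wh p = (𝓕 W₁ p).re := by rw [hWh]
    rw [hWp]
    exact div_le_div_of_nonneg_right (sq_le_sq' hre.1 hre.2) (by positivity)
  have hBdt : ENNReal.ofReal κ⁻¹ * (ENNReal.ofReal ((1 + ε) ^ 2) * gOmegaIntegral v ω) +
      ENNReal.ofReal (W0 / 2 * (4 / 3 * Real.pi * r₀ ^ 3) +
        (W0 ^ 2 * (κ * σ ^ 2 + 2 * W0) + W0 ^ 3) / (16 * Real.pi ^ 4 * κ ^ 2) * (4 * Real.pi / r₀)) ≠ ⊤ :=
    ENNReal.add_ne_top.2 ⟨ENNReal.mul_ne_top ENNReal.ofReal_ne_top (ENNReal.mul_ne_top ENNReal.ofReal_ne_top hgΩt),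
      ENNReal.ofReal_ne_top⟩
  have hLint' : ∫⁻ p, ENNReal.ofReal (D p) ≤ ENNReal.ofReal κ⁻¹ * (ENNReal.ofReal ((1 + ε) ^ 2) * gOmegaIntegral v ω) +
      ENNReal.ofReal (W0 / 2 * (4 / 3 * Real.pi * r₀ ^ 3) +
        (W0 ^ 2 * (κ * σ ^ 2 + 2 * W0) + W0 ^ 3) / (16 * Real.pi ^ 4 * κ ^ 2) * (4 * Real.pi / r₀)) := by
    simp_rw [hDA]
    refine hLint.trans ?_
    gcongr
  obtain ⟨hID, hDle⟩ := integrable_and_integral_le' hDm hD0 hLint' hBdt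
  have hE0 : 0 ≤ W0 / 2 * (4 / 3 * Real.pi * r₀ ^ 3) +
      (W0 ^ 2 * (κ * σ ^ 2 + 2 * W0) + W0 ^ 3) / (16 * Real.pi ^ 4 * κ ^ 2) * (4 * Real.pi / r₀) := by positivity
  have hDle' : ∫ p, D p ≤ n / ℓ ^ 3 * (1 + ε) ^ 2 * (gOmegaIntegral v ω).toReal +
      (W0 / 2 * (4 / 3 * Real.pi * r₀ ^ 3) +
        (W0 ^ 2 * (κ * σ ^ 2 + 2 * W0) + W0 ^ 3) / (16 * Real.pi ^ 4 * κ ^ 2) * (4 * Real.pi / r₀)) := by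
    refine hDle.trans_eq ?_
    rw [ENNReal.toReal_add (ENNReal.mul_ne_top ENNReal.ofReal_ne_top (ENNReal.mul_ne_top ENNReal.ofReal_ne_top hgΩt))
      ENNReal.ofReal_ne_top, ENNReal.toReal_mul, ENNReal.toReal_mul, ENNReal.toReal_ofReal (by positivity),
      ENNReal.toReal_ofReal (by positivity), ENNReal.toReal_ofReal hE0, hκ, inv_div]
    ring
  -- the integrated square (2.33)–(2.34)
  have hNbt : (∫⁻ p, Nb p) ≠ ⊤ := by
    rw [hNb]
    exact ne_top_of_le_ne_top (ENNReal.mul_ne_top (ENNReal.mul_ne_top (ENNReal.mul_ne_top ENNReal.ofReal_ne_top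
      (ENNReal.natCast_ne_top n)) (ENNReal.inv_ne_top.2 (by positivity))) hNPt) h232
  have hDagm : ∀ p : Space, AEStronglyMeasurable (bDagVec χ ℓ u p Φ) (volume.restrict (boxConfig n ℓ u)) :=
    fun p => (measurable_bDagVec hχc ℓ u p hΦm).aestronglyMeasurable
  have hNbt' := hNbt
  have hIN' := hIN
  simp only [hNb] at hNbt' hIN'
  have hcore0 := integral_pairing_lower_bound h228 hχ hℓ u hΦm hN2 hNbt' hDagm (A := fun p => κ * τr p + 2 * W0)
    (Wh := Wh) hAW hA0 hAe hWhe hIN' hIP hDA hID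
  have hcore : -((n : ℝ) / 2 * (∫⁻ X in boxConfig n ℓ u, ((‖Φ X‖₊ : ℝ≥0∞)) ^ 2).toReal * ∫ p : Space, D p) ≤
      (∫ p, (κ * τr p + 2 * W0) * (Nb p).toReal) + ∫ p, Wh p * pairingRe χ ℓ u p Φ := by
    simpa only [hNb] using hcore0
  clear hcore0 hNbt' hIN'
  -- bookkeeping in real numbers
  set N2 : ℝ := (∫⁻ X in boxConfig n ℓ u, ((‖Φ X‖₊ : ℝ≥0∞)) ^ 2).toReal with hN2r
  set NP : ℝ := (nPlusBoxN ℓ u Φ).toReal with hNPr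
  set T : ℝ := (kinExcForm χ ℓ s u Φ).toReal with hTr
  set gΩ : ℝ := (gOmegaIntegral v ω).toReal with hgΩr
  clear_value N2 NP T gΩ
  have hN20 : 0 ≤ N2 := by rw [hN2r]; exact ENNReal.toReal_nonneg
  have hNP0 : 0 ≤ NP := by rw [hNPr]; exact ENNReal.toReal_nonneg
  have hgΩ0 : 0 ≤ gΩ := by rw [hgΩr]; exact ENNReal.toReal_nonneg
  have hgΩle : gΩ ≤ 8 * Real.pi * a := by
    rw [hgΩr]
    have h := ENNReal.toReal_mono (ENNReal.mul_ne_top ENNReal.ofReal_ne_top hsLt) (gOmegaIntegral_le hω)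
    rwa [ENNReal.toReal_mul, ENNReal.toReal_ofReal (by positivity), ← ha_def] at h
  have h2 : κ * ∫ p, τr p * (Nb p).toReal ≤ T := by
    calc κ * ∫ p, τr p * (Nb p).toReal ≤ κ * (n / ℓ ^ 3 * T) := mul_le_mul_of_nonneg_left hIτle' hκ0.le
      _ = T := by rw [hκ]; field_simp
  have hmain := lemma24_main_term hn0'.le hℓ hε0 hε1 hgΩ0 hgΩle hN20 (ε := ε)
  have hEb := lemma24_E_bound hn0' hℓ hs hW00.le hW016
  rw [← hσ, ← hκ, ← hr₀] at hEb
  have hEt := lemma24_E_term hn0'.le hℓ ha.le hs hN20 hEb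
  -- compare with the target constants
  have p1 : 0 ≤ 32 * Real.pi * Cχ ^ 2 := by positivity
  have p2 : 0 ≤ 24 * Real.pi * CT := by positivity
  have p3 : 0 ≤ 32 / (3 * Real.pi * s ^ 3) / 2 + 16 / s := by positivity
  have p4 : 0 ≤ 16 / s + 3072 * Real.pi * s / 2 := by positivity
  have hC1 : 32 * Real.pi * Cχ ^ 2 ≤ Cfull := by rw [hCfull]; linarith only [p2, p3, p4]
  have hC2 : 24 * Real.pi * CT ≤ Cfull := by rw [hCfull]; linarith only [p1, p3, p4]
  have hC3 : 32 / (3 * Real.pi * s ^ 3) / 2 + 16 / s ≤ Cfull := by rw [hCfull]; linarith only [p1, p2, p4]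
  have hC4 : 16 / s + 3072 * Real.pi * s / 2 ≤ Cfull := by rw [hCfull]; linarith only [p1, p2, p3]
  -- error 1: the `n₊` term
  have hX0 : 0 ≤ a * (((n : ℝ) + 1) / ℓ ^ 3) * NP := by positivity
  have herr1 : 2 * W0 * ∫ p, (Nb p).toReal ≤ Cfull * a * (((n : ℝ) + 1) / ℓ ^ 3) * NP := by
    have hq : (∫ p, (Nb p).toReal) ≤ Cχ ^ 2 * (((n : ℝ) + 1) / ℓ ^ 3) * NP := by
      refine hI0le'.trans ?_
      have e : Cχ ^ 2 * (n : ℝ) / ℓ ^ 3 * NP = Cχ ^ 2 * ((n : ℝ) / ℓ ^ 3) * NP := by ring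
      rw [e]
      exact mul_le_mul_of_nonneg_right (mul_le_mul_of_nonneg_left (div_le_div_of_nonneg_right
        (le_add_of_nonneg_right zero_le_one) (pow_pos hℓ 3).le) (sq_nonneg Cχ)) hNP0
    calc 2 * W0 * ∫ p, (Nb p).toReal ≤ 2 * (16 * Real.pi * a) * (Cχ ^ 2 * (((n : ℝ) + 1) / ℓ ^ 3) * NP) :=
          mul_le_mul (by linarith only [hW016]) hq hI00 (by positivity)
      _ = 32 * Real.pi * Cχ ^ 2 * (a * (((n : ℝ) + 1) / ℓ ^ 3) * NP) := by ring
      _ ≤ Cfull * (a * (((n : ℝ) + 1) / ℓ ^ 3) * NP) := mul_le_mul_of_nonneg_right hC1 hX0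
      _ = _ := by ring
  -- error 2: the surplus of the main term
  have herr2 : 12 * Real.pi * ((n : ℝ) * n / ℓ ^ 3) * ε * a * N2 ≤
      Cfull * (n : ℝ) * a / ℓ ^ 3 * (((n : ℝ) + 1) * R ^ 2 / ℓ ^ 2) * N2 := by
    have e : 12 * Real.pi * ((n : ℝ) * n / ℓ ^ 3) * ε * a * N2 =
        24 * Real.pi * CT * ((n : ℝ) * a / ℓ ^ 3 * ((n : ℝ) * R ^ 2 / ℓ ^ 2) * N2) := by
      rw [hε]; ring
    rw [e]
    have hY0 : 0 ≤ (n : ℝ) * a / ℓ ^ 3 * (((n : ℝ) + 1) * R ^ 2 / ℓ ^ 2) * N2 := by positivity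
    have hY1 : (n : ℝ) * a / ℓ ^ 3 * ((n : ℝ) * R ^ 2 / ℓ ^ 2) * N2 ≤ (n : ℝ) * a / ℓ ^ 3 * (((n : ℝ) + 1) * R ^ 2 / ℓ ^ 2) * N2 := by
      have h1 : 0 ≤ (n : ℝ) * a / ℓ ^ 3 := by positivity
      have h2 : (n : ℝ) * R ^ 2 / ℓ ^ 2 ≤ ((n : ℝ) + 1) * R ^ 2 / ℓ ^ 2 :=
        div_le_div_of_nonneg_right (mul_le_mul_of_nonneg_right (le_add_of_nonneg_right zero_le_one) (sq_nonneg R))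
          (pow_pos hℓ 2).le
      exact mul_le_mul_of_nonneg_right (mul_le_mul_of_nonneg_left h2 h1) hN20
    calc 24 * Real.pi * CT * ((n : ℝ) * a / ℓ ^ 3 * ((n : ℝ) * R ^ 2 / ℓ ^ 2) * N2)
        ≤ 24 * Real.pi * CT * ((n : ℝ) * a / ℓ ^ 3 * (((n : ℝ) + 1) * R ^ 2 / ℓ ^ 2) * N2) :=
          mul_le_mul_of_nonneg_left hY1 p2
      _ ≤ Cfull * ((n : ℝ) * a / ℓ ^ 3 * (((n : ℝ) + 1) * R ^ 2 / ℓ ^ 2) * N2) := mul_le_mul_of_nonneg_right hC2 hY0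
      _ = _ := by ring
  -- error 3 and 4: the `E` term
  have herr3 : (n : ℝ) * N2 * ((32 / (3 * Real.pi * s ^ 3) / 2 + 16 / s) * (a / ℓ ^ 3)) ≤
      Cfull * (n : ℝ) * a / ℓ ^ 3 * 1 * N2 := by
    have hY0 : 0 ≤ (n : ℝ) * a / ℓ ^ 3 * 1 * N2 := by positivity
    calc (n : ℝ) * N2 * ((32 / (3 * Real.pi * s ^ 3) / 2 + 16 / s) * (a / ℓ ^ 3))
        = (32 / (3 * Real.pi * s ^ 3) / 2 + 16 / s) * ((n : ℝ) * a / ℓ ^ 3 * 1 * N2) := by ring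
      _ ≤ Cfull * ((n : ℝ) * a / ℓ ^ 3 * 1 * N2) := mul_le_mul_of_nonneg_right hC3 hY0
      _ = _ := by ring
  have herr4 : (n : ℝ) * N2 * ((16 / s + 3072 * Real.pi * s / 2) * (a ^ 3 * (n : ℝ) ^ 2 / ℓ ^ 5)) ≤
      Cfull * (n : ℝ) * a / ℓ ^ 3 * (a ^ 2 * ((n : ℝ) + 1) ^ 2 / ℓ ^ 2) * N2 := by
    have hY0 : 0 ≤ (n : ℝ) * a / ℓ ^ 3 * (a ^ 2 * ((n : ℝ) + 1) ^ 2 / ℓ ^ 2) * N2 := by positivity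
    have hℓ5 : (ℓ ^ 5)⁻¹ = (ℓ ^ 3)⁻¹ * (ℓ ^ 2)⁻¹ := by rw [← mul_inv, ← pow_add]
    have e1 : (n : ℝ) * N2 * ((16 / s + 3072 * Real.pi * s / 2) * (a ^ 3 * (n : ℝ) ^ 2 / ℓ ^ 5)) =
        (16 / s + 3072 * Real.pi * s / 2) * ((n : ℝ) * a / ℓ ^ 3 * (a ^ 2 * (n : ℝ) ^ 2 / ℓ ^ 2) * N2) := by
      rw [div_eq_mul_inv _ (ℓ ^ 5), hℓ5]; ring
    rw [e1]
    have hY1 : (n : ℝ) * a / ℓ ^ 3 * (a ^ 2 * (n : ℝ) ^ 2 / ℓ ^ 2) * N2 ≤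
        (n : ℝ) * a / ℓ ^ 3 * (a ^ 2 * ((n : ℝ) + 1) ^ 2 / ℓ ^ 2) * N2 := by
      have h1 : 0 ≤ (n : ℝ) * a / ℓ ^ 3 := by positivity
      have h2 : a ^ 2 * (n : ℝ) ^ 2 / ℓ ^ 2 ≤ a ^ 2 * ((n : ℝ) + 1) ^ 2 / ℓ ^ 2 :=
        div_le_div_of_nonneg_right (mul_le_mul_of_nonneg_left
          (pow_le_pow_left₀ hn0'.le (le_add_of_nonneg_right zero_le_one) 2) (sq_nonneg a)) (pow_pos hℓ 2).le
      exact mul_le_mul_of_nonneg_right (mul_le_mul_of_nonneg_left h2 h1) hN20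
    calc (16 / s + 3072 * Real.pi * s / 2) * ((n : ℝ) * a / ℓ ^ 3 * (a ^ 2 * (n : ℝ) ^ 2 / ℓ ^ 2) * N2)
        ≤ (16 / s + 3072 * Real.pi * s / 2) * ((n : ℝ) * a / ℓ ^ 3 * (a ^ 2 * ((n : ℝ) + 1) ^ 2 / ℓ ^ 2) * N2) :=
          mul_le_mul_of_nonneg_left hY1 p4
      _ ≤ Cfull * ((n : ℝ) * a / ℓ ^ 3 * (a ^ 2 * ((n : ℝ) + 1) ^ 2 / ℓ ^ 2) * N2) := mul_le_mul_of_nonneg_right hC4 hY0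
      _ = _ := by ring
  have hexp : Cfull * (n : ℝ) * a / ℓ ^ 3 * (1 + a ^ 2 * ((n : ℝ) + 1) ^ 2 / ℓ ^ 2 + ((n : ℝ) + 1) * R ^ 2 / ℓ ^ 2) * N2 =
      Cfull * (n : ℝ) * a / ℓ ^ 3 * 1 * N2 + Cfull * (n : ℝ) * a / ℓ ^ 3 * (a ^ 2 * ((n : ℝ) + 1) ^ 2 / ℓ ^ 2) * N2 +
        Cfull * (n : ℝ) * a / ℓ ^ 3 * (((n : ℝ) + 1) * R ^ 2 / ℓ ^ 2) * N2 := by ring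
  rw [hexp]
  -- main term with `D`
  have hJ : -((n : ℝ) / 2 * N2 * (n / ℓ ^ 3 * (1 + ε) ^ 2 * gΩ +
      (W0 / 2 * (4 / 3 * Real.pi * r₀ ^ 3) +
        (W0 ^ 2 * (κ * σ ^ 2 + 2 * W0) + W0 ^ 3) / (16 * Real.pi ^ 4 * κ ^ 2) * (4 * Real.pi / r₀)))) ≤
      (∫ p, (κ * τr p + 2 * W0) * (Nb p).toReal) + ∫ p, Wh p * pairingRe χ ℓ u p Φ := by
    have : (n : ℝ) / 2 * N2 * ∫ p, D p ≤ n / 2 * N2 * (n / ℓ ^ 3 * (1 + ε) ^ 2 * gΩ +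
        (W0 / 2 * (4 / 3 * Real.pi * r₀ ^ 3) +
          (W0 ^ 2 * (κ * σ ^ 2 + 2 * W0) + W0 ^ 3) / (16 * Real.pi ^ 4 * κ ^ 2) * (4 * Real.pi / r₀))) :=
      mul_le_mul_of_nonneg_left hDle' (by positivity)
    linarith only [hcore, this]
  rw [hINval, ← hA2] at hJ
  have hdist : (n : ℝ) / 2 * N2 * (n / ℓ ^ 3 * (1 + ε) ^ 2 * gΩ +
      (W0 / 2 * (4 / 3 * Real.pi * r₀ ^ 3) +
        (W0 ^ 2 * (κ * σ ^ 2 + 2 * W0) + W0 ^ 3) / (16 * Real.pi ^ 4 * κ ^ 2) * (4 * Real.pi / r₀))) =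
      n / 2 * N2 * (n / ℓ ^ 3 * (1 + ε) ^ 2 * gΩ) + n / 2 * N2 * (W0 / 2 * (4 / 3 * Real.pi * r₀ ^ 3) +
        (W0 ^ 2 * (κ * σ ^ 2 + 2 * W0) + W0 ^ 3) / (16 * Real.pi ^ 4 * κ ^ 2) * (4 * Real.pi / r₀)) := by ring
  have hdist2 : (n : ℝ) * N2 * ((32 / (3 * Real.pi * s ^ 3) / 2 + 16 / s) * (a / ℓ ^ 3) +
      (16 / s + 3072 * Real.pi * s / 2) * (a ^ 3 * n ^ 2 / ℓ ^ 5)) =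
      n * N2 * ((32 / (3 * Real.pi * s ^ 3) / 2 + 16 / s) * (a / ℓ ^ 3)) +
        n * N2 * ((16 / s + 3072 * Real.pi * s / 2) * (a ^ 3 * n ^ 2 / ℓ ^ 5)) := by ring
  linarith only [hJ, hmain, hEt, herr1, herr2, herr3, herr4, hsplitK, h2, hdist, hdist2]

/-- **Fournais 2020, Lemma 2.4, proved** (`Fournais2020_lemma24` of `PeriodicBoseGasSectorOps.lean`):
(2.28) by `Fournais2020_eq228_holds`, (2.29) on the form domain by `Fournais2020_eq229_of_rep`, (2.42) by
`Fournais2020_eq242_holds`, assembled as printed. [cite: Fournais2020, Lemma 2.4 (2.26)–(2.42)]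
[cite: FournaisSolovej2020, App. A] -/
theorem Fournais2020_lemma24_holds : Fournais2020_lemma24 :=
  Fournais2020_lemma24_of_eq228_eq242 Fournais2020_eq228_holds Fournais2020_eq242_holds

/-- **Fournais 2020, (2.43)–(2.46), proved** (`Fournais2020_eq243` of `PeriodicBoseGasSector.lean`): the
`n`-particle bound `(H_Λ(ρ_μ))_n ≥ E_Main + E_gap + E_error`, from (2.25) (`Fournais2020_eq225_holds`) and
Lemma 2.4 (`Fournais2020_lemma24_holds`) by `Fournais2020_eq243_of_eq225_lemma24`.
[cite: Fournais2020, (2.43)–(2.46), Lemma 2.3 (2.25), Lemma 2.4 (2.26)] -/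
theorem Fournais2020_eq243_holds : Fournais2020_eq243 :=
  Fournais2020_eq243_of_eq225_lemma24 Fournais2020_eq225_holds Fournais2020_lemma24_holds

/-- **Fournais 2020, Theorem 2.1, proved** (`Fournais2020_thm21` of `PeriodicBoseGasBox.lean`): the lower
bound on the localised Hamiltonian on every sector, from (2.43) by the particle-number bookkeeping
(2.47)–(2.50) (`Fournais2020_thm21_of_eq243`). [cite: Fournais2020, Thm. 2.1 (2.11), (2.43)–(2.50)]
[cite: BrietzkeFournaisSolovej2020, Thm. 6.1] -/
theorem Fournais2020_thm21_holds : Fournais2020_thm21 :=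
  Fournais2020_thm21_of_eq243 Fournais2020_eq243_holds

end Literature.MathematicalPhysics.QuantumManyBody.BoseGas

end
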